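import Summits.Langlands.Langlands.Theses.PadicReachabilityCarving

/-!
# Route PadicReachabilityCarving — Assembly

The assembly item (stmt-Langlands-26904) of the child route `PadicReachabilityCarving` (decomp-langlands lens-6 gen 19; refines DR = RootDecomp2.DeRhamMember 26480 ∧ S_p = RootDecomp2.SemisimpleMatchingAtP 26481 of route-Langlands-RootDecomp2 rev 1) for the Langlands summit:
`AbelianCoreAtP → ReachableRegularCoreAtP → ReachableIrregularCoreAtP → UnreachableCoreAtP → PadicCoreFrame → Langlands`.

This is literally the type of the route file's sorry-free deciding theorem `Summit.Langlands.Langlands.Theses.PadicReachabilityCarving.closes`.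
Nothing here proves `Langlands`: the assembly records only that the ledger items of the route, taken together, imply the summit statement.
-/

set_option linter.dupNamespace false -- project-wide option (lakefile weak.linter.dupNamespace); `Summit.Langlands.Langlands` is the mandated namespace

namespace Summit.Langlands.Langlands.Theorems

/-- **Assembly of route PadicReachabilityCarving** (stmt-Langlands-26904).  Proof: unfold `Assembly` and apply the route's deciding theorem `Theses.PadicReachabilityCarving.closes`. -/
theorem padicReachabilityCarving_assembly_proof :
    Summit.Langlands.Langlands.Theses.PadicReachabilityCarving.Assembly := by
  unfold Summit.Langlands.Langlands.Theses.PadicReachabilityCarving.Assembly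
  exact Summit.Langlands.Langlands.Theses.PadicReachabilityCarving.closes

end Summit.Langlands.Langlands.Theorems
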